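import Mathlib.Topology.Algebra.Group.Quotient
import Mathlib.Topology.Algebra.Group.Compact
import Literature.AnabelianGeometry.SemiGraphs.TreeSystemFixedPoint
import Literature.AnabelianGeometry.SemiGraphs.MorphismsOver

/-!
# Compact subgroups acting on inverse systems of trees over a base ([SemiAnbd] Thm. 3.7 (iii), p. 41)

Mochizuki, *Semi-graphs of Anabelioids*, Publ. RIMS **42** (2006) 221–322, proof of Theorem 3.7
(iii), first part (p. 41) [cite: MochizukiSemiAnbd2006, Thm. 3.7(iii) p.41]: "`H ⊆ π₁^temp(𝒢)` a
compact subgroup … the image `H_i` of `H` in `π₁^temp(𝒢)/π₁^temp(𝒢_{∞,i})` is finite … acts on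
the tree `𝒢_{∞,i}` … Since the action of `H` is over `𝒢`, it does not switch the branches of an
edge … every edge of `𝒢_{∞,i}` abuts to at least one vertex … `H` fixes at least one VERTEX … a
compatible system of vertices fixed by `H`".

This proof-only file is the topological packaging of `TreeSystemFixedPoint.lean` (the purely
combinatorial core) in the form the assembly of `CompactInVerticial` consumes: the acting group is a
topological group `Π`, the subgroup `C` is compact, each action `ρ_j : Π → Aut(T_j)` has OPEN
kernel (it factors through a discrete quotient), the trees `T_j` lie over a base semi-graph `𝔾`
and the actions are over `𝔾`:

* `finite_image_of_isCompact_of_isOpen_ker` — a compact subgroup has finite image under a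
  homomorphism with open kernel ("the image `H_i` … is finite");
* `exists_fixed_vertex_of_isCompact_over` — one tree: a compact subgroup acting over `𝔾` with open
  kernel on a tree having a vertex fixes a vertex (Lemma 1.8 (ii)(a) + no branch switching + every
  edge abuts, the latter two from `MorphismsOver.lean`);
* `exists_compatible_fixed_vertices_of_isCompact_over` — an inverse system of such trees with
  equivariant transition maps and (eventually) finite fixed-vertex sets has a compatible system of
  vertices fixed by `C`.
-/

namespace Literature.AnabelianGeometry.SemiGraphs

namespace SemiGraph

open CategoryTheory Topology

universe u v w

/-! ### Compact subgroups have finite image in discrete quotients -/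

/-- "The image `H_i` of `H` in `π₁^temp(𝒢)/π₁^temp(𝒢_{∞,i})` is finite": a compact subset of a
topological group has finite image under a homomorphism whose kernel is open.
[cite: MochizukiSemiAnbd2006, Thm. 3.7(iii) p.41] -/
theorem finite_image_of_isCompact_of_isOpen_ker {P : Type w} [Group P] [TopologicalSpace P]
    [IsTopologicalGroup P] {A : Type v} [Group A] (ρ : P →* A) (hker : IsOpen (ρ.ker : Set P))
    {C : Set P} (hC : IsCompact C) : (ρ '' C).Finite := by
  haveI : DiscreteTopology (P ⧸ ρ.ker) := QuotientGroup.discreteTopology hker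
  -- the image of `C` in the discrete quotient `Π / Ker ρ` is compact, hence finite
  have hfin : (QuotientGroup.mk '' C : Set (P ⧸ ρ.ker)).Finite :=
    (hC.image (QuotientGroup.continuous_mk (N := ρ.ker))).finite_of_discrete
  -- and `ρ` factors through the quotient
  have heq : ρ '' C = QuotientGroup.kerLift ρ '' (QuotientGroup.mk '' C) := by
    rw [Set.image_image]
    rfl
  rw [heq]
  exact hfin.image _

/-- The range of the restriction of `ρ` to a compact subgroup is finite when `Ker ρ` is open.
[cite: MochizukiSemiAnbd2006, Thm. 3.7(iii) p.41] -/
theorem finite_range_restrict_of_isCompact {P : Type w} [Group P] [TopologicalSpace P]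
    [IsTopologicalGroup P] {A : Type v} [Group A] (ρ : P →* A) (hker : IsOpen (ρ.ker : Set P))
    (C : Subgroup P) (hC : IsCompact (C : Set P)) : (Set.range (ρ.restrict C)).Finite := by
  have h := finite_image_of_isCompact_of_isOpen_ker ρ hker hC
  refine h.subset ?_
  rintro _ ⟨c, rfl⟩
  exact ⟨c, c.2, rfl⟩

/-! ### One tree over a base -/

/-- **One level of the proof of Thm. 3.7 (iii)**: a compact subgroup `C` of a topological group
acting on a tree `T` over a base `𝔾` (`ρ g ≫ p = p`), through a homomorphism with open kernel, fixes
a vertex of `T` — provided `T` has a vertex (then every edge abuts, `T` being connected).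
[cite: MochizukiSemiAnbd2006, Thm. 3.7(iii) p.41] -/
theorem exists_fixed_vertex_of_isCompact_over {P : Type w} [Group P] [TopologicalSpace P]
    [IsTopologicalGroup P] (C : Subgroup P) (hC : IsCompact (C : Set P))
    {T 𝔾 : SemiGraph.{u}} (hT : T.IsTree) (v₀ : T.Vertex) (p : T ⟶ 𝔾) (ρ : P →* Aut T)
    (hker : IsOpen (ρ.ker : Set P)) (hover : ∀ g : P, (ρ g).hom ≫ p = p) :
    ∃ v : T.Vertex, ∀ c : C, (ρ c).hom.vertexMap v = v := by
  have habut : ∀ e : T.Edge, ∃ b : T.Branch, T.edgeOf b = e ∧ (T.abuts b).isSome :=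
    fun e => exists_abuts_of_isConnected ⟨hT.isTree.1⟩ v₀ e
  have hfin : (Set.range (ρ.restrict C)).Finite := finite_range_restrict_of_isCompact ρ hker C hC
  have hnoswap : ∀ (c : C) (b : T.Branch), (ρ.restrict C c).hom.edgeMap (T.edgeOf b) = T.edgeOf b →
      (ρ.restrict C c).hom.branchMap b = b :=
    fun c b he => branchMap_eq_of_over_aut p (ρ c) (hover c) b he
  exact exists_fixed_vertex_of_noSwap hT habut (ρ.restrict C) hfin hnoswap

/-! ### An inverse system of trees over a base -/

/-- **The compatible system of fixed vertices** (proof of Thm. 3.7 (iii), p. 41, in topological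
form): `Π` a topological group, `C ≤ Π` compact; `(T_j)_{j ∈ J}` a directed inverse system of trees
over a base `𝔾`, each with a vertex, on which `Π` acts over `𝔾` through homomorphisms with open
kernels, with `Π`-equivariant transition maps on vertices; if above some level `j₀` the sets of
`C`-fixed vertices are finite, then there is a compatible system `(x_j)_{j ≥ j₀}` of vertices fixed
by `C`. [cite: MochizukiSemiAnbd2006, Thm. 3.7(iii) p.41] -/
theorem exists_compatible_fixed_vertices_of_isCompact_over {P : Type w} [Group P]
    [TopologicalSpace P] [IsTopologicalGroup P] (C : Subgroup P) (hC : IsCompact (C : Set P))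
    {J : Type v} [Preorder J] [IsDirectedOrder J] (𝔾 : SemiGraph.{u}) (T : J → SemiGraph.{u})
    (hT : ∀ j, (T j).IsTree) (v₀ : ∀ j, (T j).Vertex) (p : ∀ j, T j ⟶ 𝔾)
    (ρ : ∀ j, P →* Aut (T j)) (hker : ∀ j, IsOpen ((ρ j).ker : Set P))
    (hover : ∀ (j : J) (g : P), (ρ j g).hom ≫ p j = p j)
    (π : ∀ ⦃i j : J⦄, i ≤ j → (T j).Vertex → (T i).Vertex)
    (π_id : ∀ (j : J) (x : (T j).Vertex), π le_rfl x = x)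
    (π_comp : ∀ ⦃i j k : J⦄ (hij : i ≤ j) (hjk : j ≤ k) (x : (T k).Vertex),
      π hij (π hjk x) = π (hij.trans hjk) x)
    (hequiv : ∀ ⦃i j : J⦄ (h : i ≤ j) (g : P) (x : (T j).Vertex),
      π h ((ρ j g).hom.vertexMap x) = (ρ i g).hom.vertexMap (π h x))
    (j₀ : J)
    (hfixfin : ∀ j, j₀ ≤ j → {x : (T j).Vertex | ∀ c : C, (ρ j c).hom.vertexMap x = x}.Finite) :
    ∃ x : ∀ j : {j : J // j₀ ≤ j}, (T j.1).Vertex,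
      (∀ (j : {j : J // j₀ ≤ j}) (c : C), (ρ j.1 c).hom.vertexMap (x j) = x j) ∧
      ∀ ⦃i j : {j : J // j₀ ≤ j}⦄ (h : i.1 ≤ j.1), π h (x j) = x i := by
  have habut : ∀ (j : J) (e : (T j).Edge), ∃ b : (T j).Branch,
      (T j).edgeOf b = e ∧ ((T j).abuts b).isSome :=
    fun j e => exists_abuts_of_isConnected ⟨(hT j).isTree.1⟩ (v₀ j) e
  have hfin : ∀ j, (Set.range ((ρ j).restrict C)).Finite :=
    fun j => finite_range_restrict_of_isCompact (ρ j) (hker j) C hC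
  have hnoswap : ∀ (j : J) (c : C) (b : (T j).Branch),
      ((ρ j).restrict C c).hom.edgeMap ((T j).edgeOf b) = (T j).edgeOf b →
        ((ρ j).restrict C c).hom.branchMap b = b :=
    fun j c b he => branchMap_eq_of_over_aut (p j) (ρ j c) (hover j c) b he
  exact exists_compatible_fixed_vertices_eventually T hT habut (fun j => (ρ j).restrict C) hfin
    hnoswap π π_id π_comp (fun i j h c x => hequiv h c x) j₀ hfixfin

end SemiGraph

end Literature.AnabelianGeometry.SemiGraphs
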